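import Summits.HubbardSuperconductivity.HubbardSuperconductivity.Theorems.AnisotropyChordSpinMonotoneTwoMagnonRookGraph
import Summits.HubbardSuperconductivity.HubbardSuperconductivity.Theorems.AnisotropyChordSpinMonotoneTwoMagnonRook

/-!
# Route `AnisotropyChord`: the two-magnon sector on an ABELIAN CAYLEY GRAPH = the punctured one-body
# problem in the relative coordinate (tree-side anchor of the theory seat's `(MOM)` programme)

`G = Cay(Γ, S)` on a finite additive commutative group (`x ∼ y ↔ y − x ∈ S`, `0 ∉ S = −S`; tori,
rook graphs, circulants, two-ring ladders).  Translations are automorphisms (`cayley_adj_addRight`,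
`cayley_isVertexTransitive`), so an `Aut`-invariant two-magnon vector (every sector ground state,
`sectorGS_comp_eq_self`) is a function of the relative coordinate, `f(e_x + e_y) = φ(y − x)`, `φ` even
(`cayley_pair_eq_relative`, `cayley_relative_even`); `H(Δ) f = E f` becomes the PUNCTURED equation
`E φ(r) = −Δ(|E(G)|/4 − k + [r ∈ S]) φ(r) − Σ_{s ∈ S, r+s ≠ 0} φ(r + s)` on `Γ ∖ {0}`
(`cayley_relative_eigen`; `(L_X + (1−Δ)κ)φ = E_rel φ`, the form studied by the theory seat
`hubbard-h0-rotor-theory-1`, cycles 4–5: `(MOM)`, `(PR)`, S1, `AbelianCayleyPunctureMonotone`), and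
flat overlap / norm are relative-coordinate sums (`cayley_flat_sum`, `cayley_norm_sum`,
`cayley_flatOverlap_sq`).  Consequently **TM-VT on `Cay(Γ, S)` follows from flat-overlap monotonicity
of the punctured problem** (`cayley_twoMagnon_condensate_monotone_of_puncture`, the conjecture stated
inline as a hypothesis).  No definition is introduced; no monotonicity is claimed unconditionally.
-/

set_option linter.dupNamespace false

noncomputable section

namespace Summit.HubbardSuperconductivity.HubbardSuperconductivity.Theorems.AnisotropyChord.TwoMagnon

open Matrix Complex Finset
open Literature.MathematicalPhysics.QuantumLattice
open Literature.Combinatorics.SimpleGraph (IsVertexTransitive)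
open Literature.Combinatorics.SimpleGraph.RankThreeStronglyRegular (isRegularOfDegree_of_isVertexTransitive)
open Summit.HubbardSuperconductivity.HubbardSuperconductivity.Theorems.PolyaSchurPairBoson (xxz_sector_perronFrobenius)

variable {Γ : Type*} [AddCommGroup Γ] [Fintype Γ] [DecidableEq Γ]

section Cayley

variable {G : SimpleGraph Γ} {S : Finset Γ}

omit [Fintype Γ] [DecidableEq Γ] in
/-- Translations are automorphisms of a Cayley graph. [folklore] -/
theorem cayley_adj_addRight (hadj : ∀ x y : Γ, G.Adj x y ↔ y - x ∈ S) (v x y : Γ) :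
    G.Adj (Equiv.addRight v x) (Equiv.addRight v y) ↔ G.Adj x y := by
  rw [hadj, hadj]
  show y + v - (x + v) ∈ S ↔ y - x ∈ S
  rw [add_sub_add_right_eq_sub]

omit [Fintype Γ] [DecidableEq Γ] in
/-- **A Cayley graph is vertex-transitive** (translations). [folklore] -/
theorem cayley_isVertexTransitive (hadj : ∀ x y : Γ, G.Adj x y ↔ y - x ∈ S) :
    IsVertexTransitive G := by
  intro x y
  refine ⟨{ toEquiv := Equiv.addRight (y - x), map_rel_iff' := fun {a b} => cayley_adj_addRight hadj _ a b },
    ?_⟩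
  exact add_sub_cancel x y

variable {f : (Γ → Fin 2) → ℂ}

omit [Fintype Γ] in
/-- **Translation-invariant two-magnon vectors are functions of the relative coordinate**:
`f(e_x + e_y) = f(e_0 + e_{y−x})`. [folklore] -/
theorem cayley_pair_eq_relative (hadj : ∀ x y : Γ, G.Adj x y ↔ y - x ∈ S)
    (hfix : ∀ π : Γ ≃ Γ, (∀ x y, G.Adj (π x) (π y) ↔ G.Adj x y) → ∀ σ, f (σ ∘ π) = f σ)
    (x y : Γ) :
    f (Pi.single x 1 + Pi.single y 1) = f (Pi.single 0 1 + Pi.single (y - x) 1) := by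
  have h := hfix (Equiv.addRight x) (cayley_adj_addRight hadj x) (Pi.single x 1 + Pi.single y 1)
  rw [pair_comp_equiv] at h
  have hx : (Equiv.addRight x).symm x = 0 := by rw [Equiv.symm_apply_eq]; exact (zero_add x).symm
  have hy : (Equiv.addRight x).symm y = y - x := by rw [Equiv.symm_apply_eq]; exact (sub_add_cancel y x).symm
  rw [hx, hy] at h
  exact h.symm

omit [Fintype Γ] in
/-- The relative-coordinate profile is even: `f(e_0 + e_{−r}) = f(e_0 + e_r)`. [folklore] -/
theorem cayley_relative_even (hadj : ∀ x y : Γ, G.Adj x y ↔ y - x ∈ S)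
    (hfix : ∀ π : Γ ≃ Γ, (∀ x y, G.Adj (π x) (π y) ↔ G.Adj x y) → ∀ σ, f (σ ∘ π) = f σ)
    (r : Γ) :
    f (Pi.single 0 1 + Pi.single (-r) 1) = f (Pi.single 0 1 + Pi.single r 1) := by
  rw [pair_comm (0 : Γ) (-r), cayley_pair_eq_relative hadj hfix (-r) 0, sub_neg_eq_add, zero_add]

/-- **Neighbour sums on a Cayley graph**: `Σ_y [x ∼ y] g(y) = Σ_{s ∈ S} g(x + s)`. [folklore] -/
theorem cayley_sum_adj [DecidableRel G.Adj] (hadj : ∀ x y : Γ, G.Adj x y ↔ y - x ∈ S) (x : Γ)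
    (g : Γ → ℂ) :
    (∑ y, if G.Adj x y then g y else 0) = ∑ s ∈ S, g (x + s) := by
  have h1 : (∑ y, if G.Adj x y then g y else 0) =
      ∑ s, if s ∈ S then g (x + s) else 0 := by
    refine (Fintype.sum_equiv (Equiv.addLeft x) _ _ fun s => ?_).symm
    show (if s ∈ S then g (x + s) else 0) = if G.Adj x (x + s) then g (x + s) else 0
    have hs : G.Adj x (x + s) ↔ s ∈ S := by rw [hadj, add_sub_cancel_left]
    rw [if_congr hs rfl rfl]
  rw [h1, Finset.sum_ite_mem, Finset.univ_inter]

omit [Fintype Γ] [DecidableEq Γ] in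
/-- Reindexing a sum over a symmetric connection set by `s ↦ −s`. [folklore] -/
theorem cayley_sum_neg (hS : ∀ s ∈ S, -s ∈ S) (g : Γ → ℂ) :
    (∑ s ∈ S, g (-s)) = ∑ s ∈ S, g s := by
  refine Finset.sum_nbij' (fun s => -s) (fun s => -s) (fun s hs => hS s hs) (fun s hs => hS s hs)
    (fun s _ => neg_neg s) (fun s _ => neg_neg s) (fun s _ => rfl)

/-- **The punctured one-body equation in the relative coordinate** (`(MOM)` of the theory seat in
position space).  For an eigenvector `f` of `H(Δ) = xxzHamiltonian 1 G (−1) Δ` (`H f = E f`) on the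
Cayley graph `Cay(Γ, S)` (`0 ∉ S = −S`, degree `k`) that is fixed by all graph automorphisms, the
profile `φ(r) = f(e_0 + e_r)` satisfies, for every `r ≠ 0`,
`E φ(r) = −Δ(|E(G)|/4 − k + [r ∈ S]) φ(r) − Σ_{s ∈ S} [r + s ≠ 0] φ(r + s)`. [folklore] -/
theorem cayley_relative_eigen [DecidableRel G.Adj] (hadj : ∀ x y : Γ, G.Adj x y ↔ y - x ∈ S)
    (hS0 : (0 : Γ) ∉ S) (hS : ∀ s ∈ S, -s ∈ S) {k : ℕ} (hreg : G.IsRegularOfDegree k)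
    (hfix : ∀ π : Γ ≃ Γ, (∀ x y, G.Adj (π x) (π y) ↔ G.Adj x y) → ∀ σ, f (σ ∘ π) = f σ)
    {Δ E : ℝ} (hH : xxzHamiltonian 1 G (-1) Δ *ᵥ f = ((E : ℝ) : ℂ) • f) {r : Γ} (hr : r ≠ 0) :
    ((E : ℂ)) * f (Pi.single 0 1 + Pi.single r 1) =
      -((Δ * ((G.edgeFinset.card : ℝ) / 4 - k + (if r ∈ S then 1 else 0)) : ℝ) : ℂ) *
          f (Pi.single 0 1 + Pi.single r 1)
        - ∑ s ∈ S, (if r + s = 0 then 0 else f (Pi.single 0 1 + Pi.single (r + s) 1)) := by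
  have hdeg : ∀ v : Γ, (G.degree v : ℝ) = k := fun v => by rw [hreg v]
  have h := congrFun hH (Pi.single 0 1 + Pi.single r 1)
  rw [Pi.smul_apply, smul_eq_mul, xxz_mulVec_pair G Δ f hr.symm, hopSum_eq_two_mul G f hr.symm,
    hdeg, hdeg] at h
  -- the two neighbour sums, in the relative coordinate
  have hadj0r : G.Adj 0 r ↔ r ∈ S := by rw [hadj, sub_zero]
  have sum1 : (∑ y, if y = 0 ∨ y = r then 0 else
      if G.Adj 0 y then f (Pi.single y 1 + Pi.single r 1) else 0) =
      ∑ s ∈ S, (if r + s = 0 then 0 else f (Pi.single 0 1 + Pi.single (r + s) 1)) := by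
    have hrw : ∀ y, (if y = 0 ∨ y = r then (0 : ℂ) else
        if G.Adj 0 y then f (Pi.single y 1 + Pi.single r 1) else 0) =
        (if G.Adj 0 y then (if y = 0 ∨ y = r then 0 else f (Pi.single y 1 + Pi.single r 1)) else 0) := by
      intro y
      by_cases hy : (y = 0 ∨ y = r)
      · simp [hy]
      · simp [hy]
    simp_rw [hrw]
    rw [cayley_sum_adj hadj 0, ← cayley_sum_neg hS]
    refine Finset.sum_congr rfl fun s hs => ?_
    have hs0 : -s ≠ 0 := fun h0 => hS0 (by rw [neg_eq_zero] at h0; rwa [h0] at hs)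
    rw [zero_add]
    by_cases hsr : -s = r
    · have : r + s = 0 := by rw [← hsr, neg_add_cancel]
      rw [if_pos (Or.inr hsr), if_pos this]
    · have : r + s ≠ 0 := fun h0 => hsr (neg_eq_of_add_eq_zero_left h0)
      rw [if_neg (not_or.mpr ⟨hs0, hsr⟩), if_neg this, cayley_pair_eq_relative hadj hfix (-s) r,
        sub_neg_eq_add]
  have sum2 : (∑ y, if y = 0 ∨ y = r then 0 else
      if G.Adj r y then f (Pi.single 0 1 + Pi.single y 1) else 0) =
      ∑ s ∈ S, (if r + s = 0 then 0 else f (Pi.single 0 1 + Pi.single (r + s) 1)) := by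
    have hrw : ∀ y, (if y = 0 ∨ y = r then (0 : ℂ) else
        if G.Adj r y then f (Pi.single 0 1 + Pi.single y 1) else 0) =
        (if G.Adj r y then (if y = 0 ∨ y = r then 0 else f (Pi.single 0 1 + Pi.single y 1)) else 0) := by
      intro y
      by_cases hy : (y = 0 ∨ y = r)
      · simp [hy]
      · simp [hy]
    simp_rw [hrw]
    rw [cayley_sum_adj hadj r]
    refine Finset.sum_congr rfl fun s hs => ?_
    have hs0 : s ≠ 0 := fun h0 => hS0 (h0 ▸ hs)
    have hrs : r + s ≠ r := fun h => hs0 (by simpa using h)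
    by_cases h0 : r + s = 0
    · rw [if_pos (Or.inl h0), if_pos h0]
    · rw [if_neg (not_or.mpr ⟨h0, hrs⟩), if_neg h0]
  rw [sum1, sum2, if_congr hadj0r rfl rfl] at h
  rw [← h]
  push_cast
  ring

/-- **The flat overlap in the relative coordinate**: for a translation-invariant two-magnon vector,
`Σ_σ f(σ) = (N/2) Σ_{r ≠ 0} φ(r)` (`N = |Γ|`; `⟨φ_flat, f⟩ = Σ_σ f(σ)` by `star_flat_dotProduct`).
[folklore] -/
theorem cayley_flat_sum (hadj : ∀ x y : Γ, G.Adj x y ↔ y - x ∈ S)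
    (hfK : f ∈ spinZSector (Λ := Γ) 1 ((Fintype.card Γ : ℝ) / 2 - 2))
    (hfix : ∀ π : Γ ≃ Γ, (∀ x y, G.Adj (π x) (π y) ↔ G.Adj x y) → ∀ σ, f (σ ∘ π) = f σ) :
    2 * (∑ σ, f σ) = (Fintype.card Γ : ℂ) * ∑ r, (if r = 0 then 0 else f (Pi.single 0 1 + Pi.single r 1)) := by
  have hsupp := apply_eq_zero_of_mem_twoMagnonSector hfK
  have h2 := two_smul_sum_eq_sum_pairs f hsupp
  rw [two_smul, ← two_mul] at h2
  rw [h2]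
  have inner : ∀ x : Γ, (∑ y, if x = y then (0 : ℂ) else f (Pi.single x 1 + Pi.single y 1)) =
      ∑ r, (if r = 0 then 0 else f (Pi.single 0 1 + Pi.single r 1)) := by
    intro x
    refine (Fintype.sum_equiv (Equiv.addLeft x) _ _ fun r => ?_).symm
    show (if r = 0 then (0 : ℂ) else f (Pi.single 0 1 + Pi.single r 1)) =
      if x = x + r then 0 else f (Pi.single x 1 + Pi.single (x + r) 1)
    by_cases hr : r = 0
    · rw [if_pos hr, if_pos (by rw [hr, add_zero])]
    · rw [if_neg hr, if_neg (fun h => hr (by simpa using h.symm)),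
        cayley_pair_eq_relative hadj hfix x (x + r), add_sub_cancel_left]
  simp_rw [inner]
  rw [Finset.sum_const, Finset.card_univ, nsmul_eq_mul]

/-- **The norm in the relative coordinate**: `2‖f‖² = N · Σ_{r ≠ 0} |φ(r)|²`. [folklore] -/
theorem cayley_norm_sum (hadj : ∀ x y : Γ, G.Adj x y ↔ y - x ∈ S)
    (hfK : f ∈ spinZSector (Λ := Γ) 1 ((Fintype.card Γ : ℝ) / 2 - 2))
    (hfix : ∀ π : Γ ≃ Γ, (∀ x y, G.Adj (π x) (π y) ↔ G.Adj x y) → ∀ σ, f (σ ∘ π) = f σ) :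
    2 * (star f ⬝ᵥ f).re = (Fintype.card Γ : ℝ) *
      ∑ r, (if r = 0 then 0 else
        ((f (Pi.single 0 1 + Pi.single r 1)).re ^ 2 + (f (Pi.single 0 1 + Pi.single r 1)).im ^ 2)) := by
  have hsupp := apply_eq_zero_of_mem_twoMagnonSector hfK
  rw [two_mul_norm_sq hsupp]
  have inner : ∀ x : Γ, (∑ y, if x = y then (0 : ℝ) else
      ((f (Pi.single x 1 + Pi.single y 1)).re ^ 2 + (f (Pi.single x 1 + Pi.single y 1)).im ^ 2)) =
      ∑ r, (if r = 0 then 0 else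
        ((f (Pi.single 0 1 + Pi.single r 1)).re ^ 2 + (f (Pi.single 0 1 + Pi.single r 1)).im ^ 2)) := by
    intro x
    refine (Fintype.sum_equiv (Equiv.addLeft x) _ _ fun r => ?_).symm
    show (if r = 0 then (0 : ℝ) else
        ((f (Pi.single 0 1 + Pi.single r 1)).re ^ 2 + (f (Pi.single 0 1 + Pi.single r 1)).im ^ 2)) =
      if x = x + r then 0 else
        ((f (Pi.single x 1 + Pi.single (x + r) 1)).re ^ 2 + (f (Pi.single x 1 + Pi.single (x + r) 1)).im ^ 2)
    by_cases hr : r = 0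
    · rw [if_pos hr, if_pos (by rw [hr, add_zero])]
    · rw [if_neg hr, if_neg (fun h => hr (by simpa using h.symm)),
        cayley_pair_eq_relative hadj hfix x (x + r), add_sub_cancel_left]
  simp_rw [inner]
  rw [Finset.sum_const, Finset.card_univ, nsmul_eq_mul]

end Cayley

/-! ### The reduction: TM-VT on `Cay(Γ, S)` from flat-overlap monotonicity of the punctured problem -/

/-- **Squared flat overlap of a two-magnon sector ground state on a Cayley graph, in the relative
coordinate.**  For a normalised sector ground state `ψ` of `H(Δ)` there is a real profile
`φ ≥ 0`, `φ ≢ 0` on `Γ ∖ {0}`, even, solving the punctured equation of `cayley_relative_eigen` with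
`E = E_min`, such that `|⟨φ_flat, ψ⟩|² = (N/2)·(Σ_{r≠0} φ(r))² / Σ_{r≠0} φ(r)²`. [folklore] -/
theorem cayley_flatOverlap_sq (G : SimpleGraph Γ) [DecidableRel G.Adj] {S : Finset Γ}
    (hadj : ∀ x y : Γ, G.Adj x y ↔ y - x ∈ S) (hS0 : (0 : Γ) ∉ S) (hS : ∀ s ∈ S, -s ∈ S)
    (hG : G.Connected) {a₀ a₁ : Γ} (ha : a₀ ≠ a₁)
    {φf : (Γ → Fin 2) → ℂ} (hφf : ∀ σ, φf σ = if (∑ z, (σ z : ℕ)) = 2 then 1 else 0)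
    {Δ : ℝ} {ψ : (Γ → Fin 2) → ℂ}
    (gm : ψ ∈ spinZSector (Λ := Γ) 1 ((Fintype.card Γ : ℝ) / 2 - 2)) (gn : star ψ ⬝ᵥ ψ = 1)
    (ge : xxzHamiltonian 1 G (-1) Δ *ᵥ ψ =
      ((lowestEnergyInSector 1 (xxzHamiltonian 1 G (-1) Δ) ((Fintype.card Γ : ℝ) / 2 - 2) : ℝ) : ℂ) • ψ) :
    ∃ φ : Γ → ℝ, (∀ r, 0 ≤ φ r) ∧ (∃ r, r ≠ 0 ∧ φ r ≠ 0) ∧ (∀ r, φ (-r) = φ r) ∧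
      (∀ r, r ≠ 0 →
        lowestEnergyInSector 1 (xxzHamiltonian 1 G (-1) Δ) ((Fintype.card Γ : ℝ) / 2 - 2) * φ r =
          -(Δ * ((G.edgeFinset.card : ℝ) / 4 - (G.degree (0 : Γ) : ℝ) + (if r ∈ S then 1 else 0))) * φ r
            - ∑ s ∈ S, (if r + s = 0 then 0 else φ (r + s))) ∧
      ‖star φf ⬝ᵥ ψ‖ ^ 2 = (Fintype.card Γ : ℝ) / 2 *
        ((∑ r, if r = 0 then 0 else φ r) ^ 2 / ∑ r, if r = 0 then 0 else φ r ^ 2) := by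
  have hVT : IsVertexTransitive G := cayley_isVertexTransitive hadj
  have hreg := isRegularOfDegree_of_isVertexTransitive hVT (0 : Γ)
  -- Perron–Frobenius: a nonnegative real sector ground vector `χ`, and `ψ = c • χ`
  have hW : ∃ σ : TensorIndex Γ 2, (∑ z, (σ z : ℕ)) = 2 := ⟨_, weight_pair ha⟩
  obtain ⟨⟨χ, hχK, hχ0, hχnn, hχH⟩, -⟩ := xxz_sector_perronFrobenius G hG Δ 2 hW
  have hM : ((Fintype.card Γ * 1 : ℕ) : ℝ) / 2 - ((2 : ℕ) : ℝ) = (Fintype.card Γ : ℝ) / 2 - 2 := by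
    push_cast; ring
  rw [hM] at hχK hχH
  obtain ⟨c, hc⟩ := sectorGS_smul_of_sectorGS G hG Δ _ hχK hχ0 hχH gm ge
  have hfixχ : ∀ π : Γ ≃ Γ, (∀ x y, G.Adj (π x) (π y) ↔ G.Adj x y) → ∀ σ, χ (σ ∘ π) = χ σ :=
    fun π hπ σ => congrFun (sectorGS_comp_eq_self G hG Δ _ π hπ hχK hχH) σ
  have hreal : ∀ σ, χ σ = (((χ σ).re : ℝ) : ℂ) := fun σ =>
    Complex.ext (by rw [Complex.ofReal_re]) (by rw [Complex.ofReal_im]; exact (hχnn σ).2)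
  have hsuppχ := apply_eq_zero_of_mem_twoMagnonSector hχK
  set φ : Γ → ℝ := fun r => (χ (Pi.single 0 1 + Pi.single r 1)).re with hφ
  have hz : ∃ r, r ≠ 0 ∧ φ r ≠ 0 := by
    -- `φ ≢ 0` on `Γ ∖ {0}`: otherwise `χ = 0`
    by_contra hzero
    push Not at hzero
    apply hχ0
    funext σ
    by_cases hσ : (∑ z, (σ z : ℕ)) = 2
    · obtain ⟨i, j, hij, rfl⟩ := eq_pair_of_weight_eq_two hσ
      rw [cayley_pair_eq_relative hadj hfixχ i j, hreal, Pi.zero_apply]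
      have h := hzero (j - i) (sub_ne_zero.mpr hij.symm)
      simp only [hφ] at h
      rw [h, Complex.ofReal_zero]
    · rw [hsuppχ σ hσ, Pi.zero_apply]
  refine ⟨φ, fun r => (hχnn _).1, hz, fun r => ?_, fun r hr => ?_, ?_⟩
  · simp only [hφ]
    rw [cayley_relative_even hadj hfixχ r]
  · have h := cayley_relative_eigen hadj hS0 hS hreg hfixχ hχH hr
    have hφr : χ (Pi.single 0 1 + Pi.single r 1) = ((φ r : ℝ) : ℂ) := hreal _
    have h' : ∀ s, χ (Pi.single 0 1 + Pi.single (r + s) 1) = ((φ (r + s) : ℝ) : ℂ) := fun s => hreal _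
    rw [hφr] at h
    simp_rw [h'] at h
    have hsum : (((∑ s ∈ S, (if r + s = 0 then 0 else φ (r + s)) : ℝ)) : ℂ) =
        ∑ s ∈ S, (if r + s = 0 then (0 : ℂ) else ((φ (r + s) : ℝ) : ℂ)) := by
      rw [Complex.ofReal_sum]
      refine Finset.sum_congr rfl fun s _ => ?_
      split_ifs <;> simp
    have hite : (((if r ∈ S then (1 : ℝ) else 0) : ℝ) : ℂ) = if r ∈ S then (1 : ℂ) else 0 := by
      split_ifs <;> simp
    apply Complex.ofReal_injective
    simp only [Complex.ofReal_mul, Complex.ofReal_sub, Complex.ofReal_neg, Complex.ofReal_add,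
      Complex.ofReal_div, Complex.ofReal_natCast, hsum, hite, Complex.ofReal_ofNat] at h ⊢
    linear_combination h
  · -- the overlap
    have hflat : star φf ⬝ᵥ χ = ((((Fintype.card Γ : ℝ) / 2) * ∑ r, (if r = 0 then 0 else φ r) : ℝ) : ℂ) := by
      rw [star_flat_dotProduct hφf hsuppχ]
      have h2 := cayley_flat_sum hadj hχK hfixχ
      have hs : (∑ σ, χ σ) = (Fintype.card Γ : ℂ) *
          (∑ r, if r = 0 then 0 else χ (Pi.single 0 1 + Pi.single r 1)) / 2 := by
        rw [eq_div_iff (two_ne_zero : (2 : ℂ) ≠ 0)]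
        linear_combination h2
      have hconv : (∑ r, if r = 0 then (0 : ℂ) else χ (Pi.single 0 1 + Pi.single r 1)) =
          (((∑ r, if r = 0 then (0 : ℝ) else φ r) : ℝ) : ℂ) := by
        rw [Complex.ofReal_sum]
        refine Finset.sum_congr rfl fun r _ => ?_
        split_ifs
        · simp
        · exact hreal _
      rw [hs, hconv]
      push_cast
      ring
    have hnorm : (star χ ⬝ᵥ χ).re = (Fintype.card Γ : ℝ) / 2 * ∑ r, (if r = 0 then 0 else φ r ^ 2) := by
      have h2 := cayley_norm_sum hadj hχK hfixχ
      have : ∀ r : Γ, (if r = 0 then (0 : ℝ) else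
          ((χ (Pi.single 0 1 + Pi.single r 1)).re ^ 2 + (χ (Pi.single 0 1 + Pi.single r 1)).im ^ 2)) =
          if r = 0 then 0 else φ r ^ 2 := by
        intro r
        split_ifs
        · rfl
        · simp only [hφ, (hχnn _).2]; ring
      simp_rw [this] at h2
      linarith
    -- positivity of the norm sum
    have hN : (0 : ℝ) < Fintype.card Γ := by
      have : 0 < Fintype.card Γ := Fintype.card_pos
      exact_mod_cast this
    have hS2pos : 0 < ∑ r, (if r = 0 then 0 else φ r ^ 2) := by
      obtain ⟨r, hr, hφr⟩ := hz
      refine lt_of_lt_of_le ?_ (Finset.single_le_sum (f := fun r => if r = 0 then 0 else φ r ^ 2)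
        (fun r _ => by positivity) (Finset.mem_univ r))
      rw [if_neg hr]
      positivity
    have hcn : ‖c‖ ^ 2 * (star χ ⬝ᵥ χ).re = 1 := by
      have h := gn
      rw [hc, star_smul, smul_dotProduct, dotProduct_smul, star_dotProduct_self_eq_re χ, smul_eq_mul,
        smul_eq_mul, Complex.star_def, ← mul_assoc, Complex.conj_mul', ← Complex.ofReal_pow,
        ← Complex.ofReal_mul] at h
      exact_mod_cast h
    have hov : ‖star φf ⬝ᵥ ψ‖ ^ 2 =
        ‖c‖ ^ 2 * ((Fintype.card Γ : ℝ) / 2 * ∑ r, (if r = 0 then 0 else φ r)) ^ 2 := by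
      rw [hc, dotProduct_smul, smul_eq_mul, norm_mul, mul_pow, hflat, Complex.norm_real,
        Real.norm_eq_abs, sq_abs]
    have hc2 : ‖c‖ ^ 2 = 1 / ((Fintype.card Γ : ℝ) / 2 * ∑ r, (if r = 0 then 0 else φ r ^ 2)) := by
      rw [hnorm] at hcn
      rw [eq_div_iff (by positivity)]
      linarith
    rw [hov, hc2]
    field_simp

/-- **TM-VT on an abelian Cayley graph reduces to flat-overlap monotonicity of the punctured
one-body problem** (the theory seat's `AbelianCayleyPunctureMonotone`, stated inline): if for all
`Δ₁ ≤ Δ₂ ≤ 1` and all nonnegative, non-vanishing, even solutions `φ₁`, `φ₂` of the punctured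
equations at `Δ₁`, `Δ₂` (any eigenvalues `E₁`, `E₂`) one has
`(Σφ₁)²·Σφ₂² ≤ (Σφ₂)²·Σφ₁²` (sums over `Γ ∖ {0}`), then the two-magnon rung holds on `Cay(Γ, S)`
for all `Δ₁ ≤ Δ₂ ≤ 1`. [folklore] -/
theorem cayley_twoMagnon_condensate_monotone_of_puncture (G : SimpleGraph Γ) [DecidableRel G.Adj]
    {S : Finset Γ} (hadj : ∀ x y : Γ, G.Adj x y ↔ y - x ∈ S) (hS0 : (0 : Γ) ∉ S)
    (hS : ∀ s ∈ S, -s ∈ S) (hG : G.Connected) (hΓ : 1 < Fintype.card Γ)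
    (hmono : ∀ (Δ₁ Δ₂ E₁ E₂ : ℝ), Δ₁ ≤ Δ₂ → Δ₂ ≤ 1 → ∀ φ₁ φ₂ : Γ → ℝ,
      (∀ r, 0 ≤ φ₁ r) → (∃ r, r ≠ 0 ∧ φ₁ r ≠ 0) → (∀ r, φ₁ (-r) = φ₁ r) →
      (∀ r, r ≠ 0 → E₁ * φ₁ r =
        -(Δ₁ * ((G.edgeFinset.card : ℝ) / 4 - (G.degree (0 : Γ) : ℝ) + (if r ∈ S then 1 else 0))) * φ₁ r
          - ∑ s ∈ S, (if r + s = 0 then 0 else φ₁ (r + s))) →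
      (∀ r, 0 ≤ φ₂ r) → (∃ r, r ≠ 0 ∧ φ₂ r ≠ 0) → (∀ r, φ₂ (-r) = φ₂ r) →
      (∀ r, r ≠ 0 → E₂ * φ₂ r =
        -(Δ₂ * ((G.edgeFinset.card : ℝ) / 4 - (G.degree (0 : Γ) : ℝ) + (if r ∈ S then 1 else 0))) * φ₂ r
          - ∑ s ∈ S, (if r + s = 0 then 0 else φ₂ (r + s))) →
      (∑ r, if r = 0 then 0 else φ₁ r) ^ 2 * (∑ r, if r = 0 then 0 else φ₂ r ^ 2) ≤
        (∑ r, if r = 0 then 0 else φ₂ r) ^ 2 * (∑ r, if r = 0 then 0 else φ₁ r ^ 2))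
    {Δ₁ Δ₂ : ℝ} (h12 : Δ₁ ≤ Δ₂) (h2 : Δ₂ ≤ 1) {ψ₁ ψ₂ : (Γ → Fin 2) → ℂ}
    (g₁m : ψ₁ ∈ spinZSector (Λ := Γ) 1 ((Fintype.card Γ : ℝ) / 2 - 2)) (g₁n : star ψ₁ ⬝ᵥ ψ₁ = 1)
    (g₁e : xxzHamiltonian 1 G (-1) Δ₁ *ᵥ ψ₁ =
      ((lowestEnergyInSector 1 (xxzHamiltonian 1 G (-1) Δ₁) ((Fintype.card Γ : ℝ) / 2 - 2) : ℝ) : ℂ) • ψ₁)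
    (g₂m : ψ₂ ∈ spinZSector (Λ := Γ) 1 ((Fintype.card Γ : ℝ) / 2 - 2)) (g₂n : star ψ₂ ⬝ᵥ ψ₂ = 1)
    (g₂e : xxzHamiltonian 1 G (-1) Δ₂ *ᵥ ψ₂ =
      ((lowestEnergyInSector 1 (xxzHamiltonian 1 G (-1) Δ₂) ((Fintype.card Γ : ℝ) / 2 - 2) : ℝ) : ℂ) • ψ₂) :
    (star ψ₁ ⬝ᵥ (((∑ x, onSite x (spinRaise 1)) * (∑ y, onSite y (spinLower 1)) : Op Γ 2) *ᵥ ψ₁)).re ≤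
      (star ψ₂ ⬝ᵥ (((∑ x, onSite x (spinRaise 1)) * (∑ y, onSite y (spinLower 1)) : Op Γ 2) *ᵥ ψ₂)).re := by
  obtain ⟨a₀, a₁, ha⟩ := Fintype.one_lt_card_iff.mp hΓ
  have hVT : IsVertexTransitive G := cayley_isVertexTransitive hadj
  set φf : (Γ → Fin 2) → ℂ := fun σ => if (∑ z, (σ z : ℕ)) = 2 then 1 else 0 with hφfdef
  have hφf : ∀ σ, φf σ = if (∑ z, (σ z : ℕ)) = 2 then 1 else 0 := fun σ => rfl
  have hfix₁ : ∀ π : Γ ≃ Γ, (∀ x y, G.Adj (π x) (π y) ↔ G.Adj x y) → ∀ σ, ψ₁ (σ ∘ π) = ψ₁ σ :=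
    fun π hπ σ => congrFun (sectorGS_comp_eq_self G hG Δ₁ _ π hπ g₁m g₁e) σ
  have hfix₂ : ∀ π : Γ ≃ Γ, (∀ x y, G.Adj (π x) (π y) ↔ G.Adj x y) → ∀ σ, ψ₂ (σ ∘ π) = ψ₂ σ :=
    fun π hπ σ => congrFun (sectorGS_comp_eq_self G hG Δ₂ _ π hπ g₂m g₂e) σ
  rw [condensate_eq_flatOverlap G hVT a₀ hφf g₁m hfix₁,
    condensate_eq_flatOverlap G hVT a₀ hφf g₂m hfix₂, g₁n, g₂n]
  have hn : (0 : ℝ) < Fintype.card Γ := by exact_mod_cast (lt_trans Nat.zero_lt_one hΓ)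
  suffices hkey : ‖star φf ⬝ᵥ ψ₁‖ ^ 2 ≤ ‖star φf ⬝ᵥ ψ₂‖ ^ 2 by
    have h4 : 0 ≤ 4 / (Fintype.card Γ : ℝ) := by positivity
    nlinarith [mul_le_mul_of_nonneg_left hkey h4]
  obtain ⟨φ₁, hp₁, hz₁, he₁, hq₁, hov₁⟩ := cayley_flatOverlap_sq G hadj hS0 hS hG ha hφf g₁m g₁n g₁e
  obtain ⟨φ₂, hp₂, hz₂, he₂, hq₂, hov₂⟩ := cayley_flatOverlap_sq G hadj hS0 hS hG ha hφf g₂m g₂n g₂e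
  have hm := hmono Δ₁ Δ₂ _ _ h12 h2 φ₁ φ₂ hp₁ hz₁ he₁ hq₁ hp₂ hz₂ he₂ hq₂
  -- the norm sums are positive
  have pos : ∀ φ : Γ → ℝ, (∃ r, r ≠ 0 ∧ φ r ≠ 0) → 0 < ∑ r, (if r = 0 then 0 else φ r ^ 2) := by
    intro φ ⟨r, hr, hφr⟩
    refine lt_of_lt_of_le ?_ (Finset.single_le_sum (f := fun r => if r = 0 then 0 else φ r ^ 2)
      (fun r _ => by positivity) (Finset.mem_univ r))
    rw [if_neg hr]
    positivity
  have hS₁ := pos φ₁ hz₁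
  have hS₂ := pos φ₂ hz₂
  rw [hov₁, hov₂]
  refine mul_le_mul_of_nonneg_left ?_ (by positivity)
  rw [div_le_div_iff₀ hS₁ hS₂]
  exact hm

end Summit.HubbardSuperconductivity.HubbardSuperconductivity.Theorems.AnisotropyChord.TwoMagnon
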